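import Summits.AtomisticToContinuum.Crystallization.Theses.PricedLinkCensus
import Summits.AtomisticToContinuum.Crystallization.Theorems.TruncatedCensusGap.Negative.KappaZeroHalf
import Summits.AtomisticToContinuum.Crystallization.Theorems.PricedLinkCensusTruncatedCensusGapPeriodicStability
import Summits.AtomisticToContinuum.Crystallization.Theorems.PricedLinkCensusTruncatedCensusGapSuperstableRedistribution
import Summits.AtomisticToContinuum.Crystallization.Theorems.PricedLinkCensusTruncatedCensusGapCompactnessExtraction
import Summits.AtomisticToContinuum.Crystallization.Theorems.PricedLinkCensusTruncatedCensusGapChargeFreeOpenAtBarlow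
import Summits.AtomisticToContinuum.Crystallization.Theorems.PricedLinkCensusTruncatedCensusGapSeparatedReduction
import Literature.MathematicalPhysics.StatisticalMechanics.LocalMatchingCompactness
import Literature.MathematicalPhysics.StatisticalMechanics.StablePotentialsProofs

/-!
# Line `sharp-m-potential-compactness` — crux `PricedLinkCensus.TruncatedCensusGap`
# (stmt-AtomisticToContinuum-14230) — checked skeleton, RESHAPE r3 (lead c2) / r4 (lead c3)

Skeleton of the crux idea card `sharp-m-potential-compactness` (crux-ideate 3; triage r1-1/2/3: pass ×3),
planner's round-1 file reshaped by the line lead `prover-line-stmt-AtomisticToContinuum-14230-c2-0`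
(2026-08-16).  STATE AFTER r3 + waves 1–2: exactly ONE `sorry` — the core `stub_sharpLocalisationSeparated`
(the sharp m-potential on uniformly `1/4`-separated configurations); everything else is LANDED:
stub 1 `stub_superstableRedistribution` (p124427; used at its radius `9/4` via
`superstableRedistribution94`, proved here), stub 2b `stub_separatedReduction` (p126512, aux p126031),
stub 3 `stub_compactnessExtraction` (p124882), stub 4 `stub_chargeFreeOpenAtBarlow` (p125113, δ = 1/2000),
stub 5 `stub_periodicStability` (p84999).  The composition `TruncatedCensusGap_of` takes the core alone and
concludes the route decl BY NAME; the certificate-ready form `LocalTransferCertificate` (antisymmetric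
local transfer + pointwise inequality) is proved to imply the core.

r4 (lead c3, 2026-08-16T22Z): composition UNCHANGED (one `sorry`, the core); added the proved probe
`sharpLocalisationSeparated_sans_zeroSet` (the core minus its zero-set clause holds with `H ≡ 0`: 100 % of
the core's content is the identification of the zero set) and, under `Theorems/`, two EQUIVALENT FORMS of the
crux landed as `--supports` sub-goals (see the card's Lead report c3): the COMPACT-STRATA form
`truncatedCensusGap_of_separatedDense` (gap on uniformly 1/4-separated 2-dense configurations ⇒ crux;
charge locality p127508 + reduction p127709) and the PERIODIC form `truncatedCensusGap_iff_periodicPricing`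
(crux ⇔ every periodic `Q` pays `κ` per charged motif site above `e_χ*`; p127773 p127907 p127840).

r2 (19:45Z): self-contained stub signatures (named Props definitionally the stub types — `example`s);
crowd-free clause of `SuperstableRedistribution` through the SUB-CONFIGURATION `y ∘ f`; transfer rule
corrected (attractive cross pairs go to the MORE crowded end point); stub 5 wired.  r3 (20:41Z): the XL
stub `SuperstableRedistribution → SharpLocalisation` split into the separated core (domination instead of
the exact sum rule; no crowding clause) and the separated reduction; explicit `4a ≤ R` / `9a/2 ≤ R` in
the zero-set clauses.

THE CRUX. `TruncatedCensusGap : ∃ κ > 0, ∀ N (y : Fin N → ℝ³) injective,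
N · e_χ* + κ · #{i | ¬ IsChargeFree (1/100) y i} ≤ E_χ(y)` for the range-2 truncated Lennard-Jones
potential `V_χ = min 1 (max 0 (4 − 2r)) · V_LJ`, `e_χ* = ⨅_Q e_χ(Q)` over periodic `Q`.

THE LINE (Peierls constant by compactness). The price `κ` is not computed but EXTRACTED from a SHARP
m-POTENTIAL: a finite-radius, rigid-motion-invariant site functional `H` (a reapportioning
`H_i = e_i − e₀ + (div T)_i` of the half-pair site excess; here only its sum rule `Σ_i H_i = E_χ − N e₀`
is kept, the transfer `T` being recovered from it) which is pointwise `≥ 0` and whose zero set, on the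
separated ("tame") stratum of rooted patches, consists of near-perfect Barlow patches.  Then:

* `stub_sharpLocalisation` (XL, LOAD-BEARING; the card's Transfer `C⁺ = SharpLocalisation(R)` in
  effective form): GIVEN the superstability redistribution of `stub_superstableRedistribution`, there is
  such an `H` — sum rule, `H ≥ 0`, `R`-locality (`IsPatchLocal`), uniform continuity modulo rigid
  motions on `r₀`-separated `R`-patches (`IsTameContinuous`), EXACT ZERO SET on tame patches inside
  `NearBarlow δ 4` for every `δ > 0` at a scale `a ≤ R/4` (r2: the clause `4a ≤ R` is explicit, as in
  ffcg's `PerfectGerm`, so that the `3a`-data of the compactness conclusion lies inside the patch) (Barlow stackings `barlowStacking a c s` with FREE layer spacing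
  `c ∈ [0.812a, 0.821a]`, so the relaxed `V_χ`-optimal hcp, `c/a = 1.63142/2`, is matched exactly), a
  floor `M₀ > 0` at crowded roots, and `e₀` approached by finite clusters (so `e₀ = e_∞(V_χ)`; the crux's
  `e_χ*` enters only through `e_χ* ≤ e₀`, never as a lower bound — Disproof.lean's "downward closed in
  `e_χ*`").  It CONTAINS finite-range energetic crystallization for `V_χ` in `d = 3` (open) and implies
  the tree's weakest known sufficient form of the crux, the metric defect gap of line
  frustration-free-census-germ (`Theorems/…MetricDefectReduction.lean`, p122076).
* `stub_superstableRedistribution` (M–L): Ruelle superstability of `V_χ` in TRANSFER form at the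
  explicit crowding scale `1/4` — a local null-Lagrangian `F` (`Σ_i F_i = 0`, `F = 0` on `1/4`-tame
  patches) with `e_i/2 + F_i ≥ 1` at `1/4`-crowded sites and `≥` the crowd-free sub-configuration's half
  site energy at crowd-free sites.  Construction (`ρ = 9/4`): charge every ATTRACTIVE pair `{j,k}`
  (`V_χ(r_jk) < 0`) entirely to the end point with the LARGER `1/4`-count `n(·)` (number of sites within
  `1/4`, itself included; ties keep the even split).  At a crowded site of count `m ≥ 2` the own
  repulsion `½ (m−1) V_χ(1/4) ≈ 7.0e5 (m−1)` beats what it is charged, `≤ (1/12) · #{k ∈ B(i,2) :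
  n(k) ≤ m} ≤ (32³/12) · m ≈ 2731 m` (cover `B(i,2)` by `32³` cubes of side `1/8 <` diameter `1/4`: a cube
  holding a site of count `≤ m` holds `≤ m` sites); at a crowd-free site every crowded attractive partner
  is charged to the partner and every repulsive one is `≥ 0`, leaving at least the crowd-free half site
  energy.  This is the reduction of every local construction to `1/4`-separated configurations.
* `stub_compactnessExtraction` (M; the card's namesake): for ANY `R`-local, tame-continuous, non-negative
  site functional whose tame zero set lies in `NearBarlow δ 4` for all `δ`, and for every `δ > 0`, there
  is `κ > 0` with `H_i < κ` on a tame patch `⇒ NearBarlow δ 3` (restrict to the patch by locality; tuples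
  of `≤ K(R,r₀)` points in the closed shell `r₀ ≤ |p| ≤ R` form a compact set whose limits are again
  injective and tame; continuity gives `H(limit) = 0`; the zero set at radius `4a` and the Barlow minimal
  distance `min a c ≥ 0.812a` (`le_dist_of_mem_barlowStacking`) transfer the matching back at radius
  `3a`; the in-plane Barlow point at `√13 a < 4a` forces `3.6 a ≤ R + δa`, so the `3a`-data lies inside
  the patch).  Twin of the LANDED Knabe compactness of line ffcg (p85371,
  `Theorems/…KnabeCompactness.lean`) with (lsc + floor) replaced by tame-continuity.
* `stub_chargeFreeOpenAtBarlow` (M; provable now): `δ = 1/1000`: first-shell spread `≤ 0.368 %` on the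
  spacing window, bond test `(d_max + 2δ) ≤ 1.01 (d_min − 2δ)` holds for `δ ≤ 0.00157`, every other
  Barlow distance `≥ 1.4096a`; rings `= 4`.  Route in: the LANDED abstract open margin
  `Theorems.PricedLinkCensusTruncatedCensusGap.isChargeFree_of_germMatched` (p85261, any pseudo-metric
  space, any reference set `T` with a 12/4 window link) + the LANDED window link
  `stub_barlowWindowLink` (p85249, every `c ∈ [0.81a, 0.85a]`).
* `stub_periodicStability` (S): `BddBelow (range e_χ)` — LANDED verbatim as
  `Theorems.PricedLinkCensusTruncatedCensusGap.stub_periodicStability` (p84999); kept as a stub only so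
  that the composition's hypotheses are registered names.

COMPOSITION (sorry-free, kernel-checked; the round-1 glue): `TruncatedCensusGap_of` takes the core
(keyed BY NAME through the `Registered.stub_*` alias), obtains `SharpLocalisation` from the landed
reduction and redistribution, and concludes
`Summit.AtomisticToContinuum.Crystallization.Theses.PricedLinkCensus.TruncatedCensusGap` BY NAME:
(1) `e_χ* ≤ e₀` from `stub_periodicStability`, the cluster clause and the LANDED
`Theorems.iInf_energyPerParticle_le_div` (Negative/KappaZeroHalf, p69766); (2) every charged site is
either crowd-free & tame — then `H_i ≥ κ(δ₁)` by compactness + the open margin —, or crowded —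
`H_i ≥ M₀` —, or crowd-free & non-tame — then some CROWDED site lies within `R` of it, and at most
`K = (2R/r₀ + 1)³` crowd-free sites lie within `R` of any point (`card_le_of_separated_of_dist_le`), so
these are paid for by the crowded sites' floor: `κ' = min κ (M₀/(K+1))`; (3) `Σ_i H_i = E_χ − N e₀ ≥
κ' · #charged` and `N e_χ* ≤ N e₀`.

DISPROOF USED (`Cruxes/TruncatedCensusGap/Disproof.lean`, cdisprove g2, unchanged since
2026-08-15T23:17Z; re-read by lead c2 2026-08-16T19:35Z): `truncatedCensusGap_false_without_injective`
(§2, Negative/WithoutInjective p69790) — injectivity is consumed quantitatively by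
`stub_superstableRedistribution` (crowding floors use `V_χ(r) → +∞`, never the junk `V_χ 0 = 0`) and
by the packing count in the glue; `truncatedCensusGap_bddBelow` / `…_kappa_zero_iff_bddBelow` (§3/§5,
Negative/KappaZeroHalf p69766) — `BddBelow` is its own (landed) stub and `iInf_energyPerParticle_le_div`
is used verbatim in the glue; §6 `not_isChargeFree_of_short_bond` + NUMERICS (any valid `κ ≤ 2.7e-5`,
elastic) — consistent: `κ` is a compactness infimum of a functional vanishing quadratically at hcp*;
§7 near-miss (periodic pricing) not needed.  `-- Targets`: none filed.  No stub is an instance refuted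
by a landed Negative lemma.
-/

noncomputable section

namespace Summit.AtomisticToContinuum.Crystallization.Cruxes.TruncatedCensusGap.SharpMPotentialCompactness

open scoped BigOperators Classical
open Literature.MathematicalPhysics.StatisticalMechanics Literature.Geometry.DiscreteGeometry
open Summit.AtomisticToContinuum.Crystallization.Theses.PricedLinkCensus (TruncatedCensusGap)

/-! ## Objects of the line -/

/-- Ambient space. -/
abbrev E3 := EuclideanSpace ℝ (Fin 3)

/-- A SITE FUNCTIONAL: a real number attached to every site of every finite configuration
(`h : (N : ℕ) → (Fin N → ℝ³) → Fin N → ℝ`, the shape pinned by the card's companion statement). -/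
abbrev SiteFun := (N : ℕ) → (Fin N → E3) → Fin N → ℝ

/-- The range-2 truncated Lennard-Jones potential of the crux, `V_χ = χ · V_LJ`,
`χ(r) = min 1 (max 0 (4 − 2r))` (literally the crux's `fun r => …`). -/
def Vχ (r : ℝ) : ℝ := min 1 (max 0 (4 - 2 * r)) * lennardJones r

/-- `e_χ* = ⨅` over periodic configurations of the `V_χ` energy per particle (the crux's constant). -/
def eStar : ℝ := ⨅ Q : PeriodicConfiguration 3, Q.energyPerParticle Vχ

/-- Beyond `r = 2` the truncated potential vanishes. -/
theorem Vχ_eq_zero_of_two_le (r : ℝ) (hr : 2 ≤ r) : Vχ r = 0 := by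
  have h : max 0 (4 - 2 * r) = 0 := max_eq_left (by linarith)
  simp [Vχ, h]

/-- Site `i` is CROWD-FREE at scale `ℓ`: no other site within distance `< ℓ` of it. -/
def IsCrowdFree (ℓ : ℝ) {N : ℕ} (y : Fin N → E3) (i : Fin N) : Prop :=
  ∀ k : Fin N, k ≠ i → ℓ ≤ dist (y k) (y i)

/-- The rooted `R`-patch of `i` is TAME at scale `r₀`: all sites of the closed `R`-ball about `y i`
(root included) are pairwise `≥ r₀` apart.  The compact stratum of patch space. -/
def IsTamePatch (R r₀ : ℝ) {N : ℕ} (y : Fin N → E3) (i : Fin N) : Prop :=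
  ∀ j k : Fin N, j ≠ k → dist (y j) (y i) ≤ R → dist (y k) (y i) ≤ R → r₀ ≤ dist (y j) (y k)

/-- `H` is `R`-LOCAL AND RIGID-MOTION INVARIANT: its value at a site depends only on the configuration
in the closed `R`-ball about the site, up to isometries of `ℝ³` and relabelling (if an isometry `g`
carries the root to the root and the closed `R`-patch into the other configuration, onto its closed
`R`-patch, the values agree). -/
def IsPatchLocal (R : ℝ) (H : SiteFun) : Prop :=
  ∀ (N N' : ℕ) (y : Fin N → E3) (y' : Fin N' → E3) (i : Fin N) (i' : Fin N') (g : E3 ≃ᵃⁱ[ℝ] E3),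
    Function.Injective y → Function.Injective y' → g (y i) = y' i' →
    (∀ j : Fin N, dist (y j) (y i) ≤ R → g (y j) ∈ Set.range y') →
    (∀ j' : Fin N', dist (y' j') (y' i') ≤ R → y' j' ∈ g '' Set.range y) →
    H N y i = H N' y' i'

/-- `H` is UNIFORMLY CONTINUOUS MODULO RIGID MOTIONS ON THE TAME STRATUM: for every `ε > 0` there is
`θ > 0` such that two tame rooted `R`-patches which are BIJECTIVELY `θ`-matched after an isometry
fixing the roots have values within `ε`.  (Bijective matching compares only patches with the same
number of points, so no taper at the sphere `|x| = R` is imposed; with `θ`-matching for every `θ > 0`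
it contains isometry invariance on the tame stratum.) -/
def IsTameContinuous (R r₀ : ℝ) (H : SiteFun) : Prop :=
  ∀ ε : ℝ, 0 < ε → ∃ θ : ℝ, 0 < θ ∧
    ∀ (N N' : ℕ) (y : Fin N → E3) (y' : Fin N' → E3) (i : Fin N) (i' : Fin N')
      (g : E3 ≃ᵃⁱ[ℝ] E3),
      Function.Injective y → Function.Injective y' →
      IsTamePatch R r₀ y i → IsTamePatch R r₀ y' i' → g (y i) = y' i' →
      (∃ e : {j : Fin N // dist (y j) (y i) ≤ R} ≃ {j' : Fin N' // dist (y' j') (y' i') ≤ R},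
        ∀ j, dist (g (y j.1)) (y' (e j).1) ≤ θ) →
      |H N y i - H N' y' i'| ≤ ε

/-- Site `i` of `y` is `δ`-NEAR-BARLOW AT RADIUS `ρ`: for some scale `a > 0`, some layer spacing
`c ∈ [0.812 a, 0.821 a]` (a window around the ideal `a√(2/3) = 0.8165a` containing the relaxed
`V_χ`-optimal hcp `c = 0.8157a`), some Hägg sequence `s` and some isometry `g` of `ℝ³`, the
configuration is `a/2`-separated within `ρ a` of `y i` and TWO-WAY `δ a`-matched there
(`BallMatch`) with `g '' barlowStacking a c s`. -/
def NearBarlow (δ ρ : ℝ) {N : ℕ} (y : Fin N → E3) (i : Fin N) : Prop :=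
  ∃ (a c : ℝ) (s : ℤ → ℤ) (g : E3 ≃ᵃⁱ[ℝ] E3), 0 < a ∧ 812 / 1000 * a ≤ c ∧ c ≤ 821 / 1000 * a ∧
    IsHaggSeq s ∧
    (∀ j k : Fin N, j ≠ k → dist (y j) (y i) ≤ ρ * a → a / 2 ≤ dist (y j) (y k)) ∧
    BallMatch (δ * a) (ρ * a) (y i) (Set.range y) (g '' barlowStacking a c s)

/-! ## Small API (monotonicity), for the provers of the stubs -/

/-- Tameness is antitone in the radius. -/
theorem IsTamePatch.anti {R R' r₀ : ℝ} {N : ℕ} {y : Fin N → E3} {i : Fin N}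
    (h : IsTamePatch R r₀ y i) (hR : R' ≤ R) : IsTamePatch R' r₀ y i :=
  fun j k hjk hj hk => h j k hjk (hj.trans hR) (hk.trans hR)

/-- Tameness is antitone in the separation scale. -/
theorem IsTamePatch.of_le {R r₀ r₀' : ℝ} {N : ℕ} {y : Fin N → E3} {i : Fin N}
    (h : IsTamePatch R r₀ y i) (hr : r₀' ≤ r₀) : IsTamePatch R r₀' y i :=
  fun j k hjk hj hk => hr.trans (h j k hjk hj hk)

/-- Crowd-freeness is antitone in the scale. -/
theorem IsCrowdFree.of_le {ℓ ℓ' : ℝ} {N : ℕ} {y : Fin N → E3} {i : Fin N}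
    (h : IsCrowdFree ℓ y i) (hℓ : ℓ' ≤ ℓ) : IsCrowdFree ℓ' y i :=
  fun k hk => hℓ.trans (h k hk)

/-- A tame patch of radius `R ≥ 0` has a crowd-free root (at the same scale). -/
theorem IsTamePatch.isCrowdFree_of_forall {R r₀ : ℝ} {N : ℕ} {y : Fin N → E3} {i : Fin N}
    (h : IsTamePatch R r₀ y i) (hR : 0 ≤ R) (hfar : ∀ k : Fin N, R < dist (y k) (y i) → r₀ ≤ dist (y k) (y i)) :
    IsCrowdFree r₀ y i := by
  intro k hk
  by_cases hkR : dist (y k) (y i) ≤ R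
  · exact h k i hk hkR (by rw [dist_self]; exact hR)
  · exact hfar k (lt_of_not_ge hkR)

/-- Near-Barlow is monotone in the tolerance. -/
theorem NearBarlow.mono {δ δ' ρ : ℝ} {N : ℕ} {y : Fin N → E3} {i : Fin N}
    (h : NearBarlow δ ρ y i) (hδ : δ ≤ δ') : NearBarlow δ' ρ y i := by
  obtain ⟨a, c, s, g, ha, hc1, hc2, hs, hsep, hmatch⟩ := h
  exact ⟨a, c, s, g, ha, hc1, hc2, hs, hsep,
    hmatch.mono (mul_le_mul_of_nonneg_right hδ ha.le) le_rfl⟩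

/-! ## The five statements of the line -/

/-- STATEMENT of `stub_superstableRedistribution` — RUELLE SUPERSTABILITY OF `V_χ` IN TRANSFER FORM,
at the explicit crowding scale `ℓ = 1/4` with floor `1`.  There are a radius `ρ` and a LOCAL
NULL-LAGRANGIAN `F` (rigid-motion-invariant `ρ`-local site functional with `Σ_i F_i = 0` on every finite
injective configuration, vanishing at sites whose `ρ`-patch is `1/4`-tame) such that the redistributed
half site energies `e_i/2 + F_i` are `≥ 1` at every `1/4`-crowded site and, at every crowd-free site,
at least the half site energy of that site in the SUB-CONFIGURATION `y ∘ f` of all crowd-free sites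
(`f : Fin M ↪ Fin N` with range exactly the crowd-free sites).  (Construction, `ρ = 9/4`: charge each
ATTRACTIVE pair entirely to the end point with the LARGER `1/4`-count, ties split evenly; at a crowded
site of count `m ≥ 2` the own repulsion `½ (m−1) V_χ(1/4) ≈ 7.0e5 (m−1)` beats the charges
`(1/12) · #{k ∈ B(i,2) : n(k) ≤ m} ≤ (32³/12) m`, each cube of side `1/8` of a cover of `B(i,2)`
holding at most `m` sites of count `≤ m`.)  Injectivity is load-bearing here (Disproof §2: `V_χ(r) → +∞`
as `r → 0⁺` is used, never the junk `V_χ 0 = 0`). -/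
def SuperstableRedistribution : Prop :=
  ∃ (ρ : ℝ) (F : SiteFun), IsPatchLocal ρ F ∧
    (∀ (N : ℕ) (y : Fin N → E3), Function.Injective y → ∑ i, F N y i = 0) ∧
    (∀ (N : ℕ) (y : Fin N → E3) (i : Fin N), Function.Injective y →
      IsTamePatch ρ (1 / 4) y i → F N y i = 0) ∧
    (∀ (N M : ℕ) (y : Fin N → E3) (f : Fin M ↪ Fin N) (i : Fin M), Function.Injective y →
      (∀ k : Fin N, k ∈ Set.range f ↔ IsCrowdFree (1 / 4) y k) →
      siteEnergy Vχ (y ∘ f) i / 2 ≤ siteEnergy Vχ y (f i) / 2 + F N y (f i)) ∧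
    (∀ (N : ℕ) (y : Fin N → E3) (i : Fin N), Function.Injective y → ¬ IsCrowdFree (1 / 4) y i →
      1 ≤ siteEnergy Vχ y i / 2 + F N y i)

/-- `SuperstableRedistribution` AT THE EXPLICIT RADIUS `ρ = 9/4` (r3): the same five clauses with the
locality / tameness radius pinned to `9/4` — the radius of the LANDED construction (p124427, cloud form
of the transfer).  PROVED below (`superstableRedistribution94`) from the landed file's public lemmas;
it is the form the separated reduction consumes (an unknown `ρ` could exceed the m-potential's own
locality radius). -/
def SuperstableRedistribution94 : Prop :=
  ∃ F : SiteFun,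
    (∀ (N N' : ℕ) (y : Fin N → E3) (y' : Fin N' → E3) (i : Fin N) (i' : Fin N') (g : E3 ≃ᵃⁱ[ℝ] E3),
      Function.Injective y → Function.Injective y' → g (y i) = y' i' →
      (∀ j : Fin N, dist (y j) (y i) ≤ 9 / 4 → g (y j) ∈ Set.range y') →
      (∀ j' : Fin N', dist (y' j') (y' i') ≤ 9 / 4 → y' j' ∈ g '' Set.range y) →
      F N y i = F N' y' i') ∧
    (∀ (N : ℕ) (y : Fin N → E3), Function.Injective y → ∑ i, F N y i = 0) ∧
    (∀ (N : ℕ) (y : Fin N → E3) (i : Fin N), Function.Injective y →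
      IsTamePatch (9 / 4) (1 / 4) y i → F N y i = 0) ∧
    (∀ (N M : ℕ) (y : Fin N → E3) (f : Fin M ↪ Fin N) (i : Fin M), Function.Injective y →
      (∀ k : Fin N, k ∈ Set.range f ↔ IsCrowdFree (1 / 4) y k) →
      siteEnergy Vχ (y ∘ f) i / 2 ≤ siteEnergy Vχ y (f i) / 2 + F N y (f i)) ∧
    (∀ (N : ℕ) (y : Fin N → E3) (i : Fin N), Function.Injective y → ¬ IsCrowdFree (1 / 4) y i →
      1 ≤ siteEnergy Vχ y i / 2 + F N y i)

/-- STATEMENT of `stub_sharpLocalisation` (conclusion) — THE SHARP m-POTENTIAL, effective form of the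
card's Transfer `C⁺`.  There are a locality radius `R`, a separation scale `r₀ > 0`, an energy `e₀`, a
floor `M₀ > 0` and a site functional `H` with: (domination; r3: `=` weakened to `≤`, which is all the
composition uses) `Σ_i H_i(y) ≤ E_χ(y) − N e₀` on finite injective `y`; (positivity) `H ≥ 0`; (locality) `IsPatchLocal R H`; (continuity)
`IsTameContinuous R r₀ H`; (SHARP ZERO SET) a tame site with `H_i = 0` is `δ`-near-Barlow at radius `4`
for EVERY `δ > 0`; (crowding floor) `H_i ≥ M₀` at `r₀`-crowded sites; (`e₀` is the cluster ground-state
energy per particle from above) for every `ε > 0` some finite injective cluster has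
`E_χ ≤ N (e₀ + ε)`.  With `H ≥ 0` and the sum rule this pins `e₀ = e_∞(V_χ)`; the zero set forces
`e₀ = e_χ(hcp*)`, i.e. this statement CONTAINS finite-range energetic crystallization for `V_χ` (open) —
declared, not hidden (triage common ground (3)). -/
def SharpLocalisation : Prop :=
  ∃ (R r₀ e₀ M₀ : ℝ) (H : SiteFun), 0 < r₀ ∧ 0 < M₀ ∧
    (∀ (N : ℕ) (y : Fin N → E3), Function.Injective y →
      ∑ i, H N y i ≤ interactionEnergy Vχ y - (N : ℝ) * e₀) ∧
    (∀ (N : ℕ) (y : Fin N → E3) (i : Fin N), Function.Injective y → 0 ≤ H N y i) ∧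
    IsPatchLocal R H ∧ IsTameContinuous R r₀ H ∧
    (∀ (N : ℕ) (y : Fin N → E3) (i : Fin N), Function.Injective y → IsTamePatch R r₀ y i →
      H N y i = 0 → ∀ δ : ℝ, 0 < δ →
        ∃ (a c : ℝ) (s : ℤ → ℤ) (g : E3 ≃ᵃⁱ[ℝ] E3), 0 < a ∧ 4 * a ≤ R ∧
          812 / 1000 * a ≤ c ∧ c ≤ 821 / 1000 * a ∧ IsHaggSeq s ∧
          (∀ j k : Fin N, j ≠ k → dist (y j) (y i) ≤ 4 * a → a / 2 ≤ dist (y j) (y k)) ∧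
          BallMatch (δ * a) (4 * a) (y i) (Set.range y) (g '' barlowStacking a c s)) ∧
    (∀ (N : ℕ) (y : Fin N → E3) (i : Fin N), Function.Injective y → ¬ IsCrowdFree r₀ y i →
      M₀ ≤ H N y i) ∧
    (∀ ε : ℝ, 0 < ε → ∃ (N : ℕ) (y : Fin N → E3), 0 < N ∧ Function.Injective y ∧
      interactionEnergy Vχ y ≤ (N : ℝ) * (e₀ + ε))

/-- `y` is UNIFORMLY `1/4`-SEPARATED: all sites pairwise at distance `≥ 1/4` (the compact strata
on which the superstability redistribution leaves the construction of the m-potential; r3). -/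
def IsSeparated {N : ℕ} (y : Fin N → E3) : Prop :=
  ∀ j k : Fin N, j ≠ k → 1 / 4 ≤ dist (y j) (y k)

/-- STATEMENT of `stub_sharpLocalisationSeparated` (r3; THE CORE after r3) — THE SHARP m-POTENTIAL
ON UNIFORMLY SEPARATED CONFIGURATIONS.  There are a radius `R ≥ 9/4`, an energy `e₀` and a site
functional `H` such that ON `1/4`-SEPARATED finite injective configurations: (domination — r3: the exact
sum rule of r1 weakened to an inequality, all the composition uses) `Σ_i H_i(y) ≤ E_χ(y) − N e₀`;
(positivity) `H ≥ 0`; (locality) patch-locality at radius `R − 1/4`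
between separated configurations; (continuity) uniform continuity modulo rigid motions under
bijective `θ`-matching of closed `R`-patches (no tameness side condition: separated patches are tame);
(SHARP ZERO SET) `H_i = 0` only if `i` is `δ`-near-Barlow at radius `4a` for every `δ > 0`, at a scale
with `9a/2 ≤ R`; and (`e₀` from above) finite injective clusters with `E_χ ≤ N (e₀ + ε)` exist for
every `ε > 0`.  No crowding clause at all: crowding is handled once and for all by the LANDED
superstability redistribution (p124427) through `stub_separatedReduction`.  Still CONTAINS
finite-range energetic crystallization for `V_χ` in `d = 3` (declared): it is the compact-strata form
of the card's Transfer `C⁺`, the statement an SOS / interval certificate would target. -/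
def SharpLocalisationSeparated : Prop :=
  ∃ (R e₀ : ℝ) (H : SiteFun), 9 / 4 ≤ R ∧
    (∀ (N : ℕ) (y : Fin N → E3), Function.Injective y → IsSeparated y →
      ∑ i, H N y i ≤ interactionEnergy Vχ y - (N : ℝ) * e₀) ∧
    (∀ (N : ℕ) (y : Fin N → E3) (i : Fin N), Function.Injective y → IsSeparated y → 0 ≤ H N y i) ∧
    (∀ (N N' : ℕ) (y : Fin N → E3) (y' : Fin N' → E3) (i : Fin N) (i' : Fin N') (g : E3 ≃ᵃⁱ[ℝ] E3),
      Function.Injective y → Function.Injective y' → IsSeparated y → IsSeparated y' →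
      g (y i) = y' i' →
      (∀ j : Fin N, dist (y j) (y i) ≤ R - 1 / 4 → g (y j) ∈ Set.range y') →
      (∀ j' : Fin N', dist (y' j') (y' i') ≤ R - 1 / 4 → y' j' ∈ g '' Set.range y) →
      H N y i = H N' y' i') ∧
    (∀ ε : ℝ, 0 < ε → ∃ θ : ℝ, 0 < θ ∧
      ∀ (N N' : ℕ) (y : Fin N → E3) (y' : Fin N' → E3) (i : Fin N) (i' : Fin N')
        (g : E3 ≃ᵃⁱ[ℝ] E3),
        Function.Injective y → Function.Injective y' → IsSeparated y → IsSeparated y' →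
        g (y i) = y' i' →
        (∃ e : {j : Fin N // dist (y j) (y i) ≤ R} ≃ {j' : Fin N' // dist (y' j') (y' i') ≤ R},
          ∀ j, dist (g (y j.1)) (y' (e j).1) ≤ θ) →
        |H N y i - H N' y' i'| ≤ ε) ∧
    (∀ (N : ℕ) (y : Fin N → E3) (i : Fin N), Function.Injective y → IsSeparated y →
      H N y i = 0 → ∀ δ : ℝ, 0 < δ →
        ∃ (a c : ℝ) (s : ℤ → ℤ) (g : E3 ≃ᵃⁱ[ℝ] E3), 0 < a ∧ 9 / 2 * a ≤ R ∧
          812 / 1000 * a ≤ c ∧ c ≤ 821 / 1000 * a ∧ IsHaggSeq s ∧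
          (∀ j k : Fin N, j ≠ k → dist (y j) (y i) ≤ 4 * a → a / 2 ≤ dist (y j) (y k)) ∧
          BallMatch (δ * a) (4 * a) (y i) (Set.range y) (g '' barlowStacking a c s)) ∧
    (∀ ε : ℝ, 0 < ε → ∃ (N : ℕ) (y : Fin N → E3), 0 < N ∧ Function.Injective y ∧
      interactionEnergy Vχ y ≤ (N : ℝ) * (e₀ + ε))

/-- THE CERTIFICATE-READY FORM (r3 remark, not a stub) — A LOCAL TRANSFER CERTIFICATE: a patch
functional `Φ ≥ 0` and an ANTISYMMETRIC pair transfer `T` of finite range `R`, patch-local, with the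
POINTWISE m-potential inequality `Φ_i + e₀ ≤ e_i/2 + Σ_j T(i,j)` at every site of every separated
configuration (plus the locality / continuity / zero-set / cluster clauses of
`SharpLocalisationSeparated` for `Φ`).  Summing the pointwise inequality kills the transfer, so
`LocalTransferCertificate → SharpLocalisationSeparated` (`sharpLocalisationSeparated_of_certificate`);
conversely a NON-local transfer always exists (`T_ij = (ρ_i − ρ_j)/N`), so it is the locality of `T`
that makes this the finite-dimensional statement an SOS / interval-arithmetic certificate on the
compact space of separated rooted `2R`-patches would establish — the recommended target for the
constructor of the core. -/
def LocalTransferCertificate : Prop :=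
  ∃ (R e₀ : ℝ) (Φ : SiteFun) (T : (N : ℕ) → (Fin N → E3) → Fin N → Fin N → ℝ), 9 / 4 ≤ R ∧
    (∀ (N : ℕ) (y : Fin N → E3) (i j : Fin N), Function.Injective y → IsSeparated y →
      T N y i j = -T N y j i) ∧
    (∀ (N : ℕ) (y : Fin N → E3) (i j : Fin N), Function.Injective y → IsSeparated y →
      R < dist (y i) (y j) → T N y i j = 0) ∧
    (∀ (N N' : ℕ) (y : Fin N → E3) (y' : Fin N' → E3) (i j : Fin N) (i' j' : Fin N')
      (g : E3 ≃ᵃⁱ[ℝ] E3), Function.Injective y → Function.Injective y' →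
      IsSeparated y → IsSeparated y' → g (y i) = y' i' → g (y j) = y' j' →
      (∀ k : Fin N, dist (y k) (y i) ≤ 2 * R → g (y k) ∈ Set.range y') →
      (∀ k' : Fin N', dist (y' k') (y' i') ≤ 2 * R → y' k' ∈ g '' Set.range y) →
      T N y i j = T N' y' i' j') ∧
    (∀ (N : ℕ) (y : Fin N → E3) (i : Fin N), Function.Injective y → IsSeparated y →
      0 ≤ Φ N y i ∧ Φ N y i + e₀ ≤ siteEnergy Vχ y i / 2 + ∑ j, T N y i j) ∧
    (∀ (N N' : ℕ) (y : Fin N → E3) (y' : Fin N' → E3) (i : Fin N) (i' : Fin N') (g : E3 ≃ᵃⁱ[ℝ] E3),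
      Function.Injective y → Function.Injective y' → IsSeparated y → IsSeparated y' →
      g (y i) = y' i' →
      (∀ j : Fin N, dist (y j) (y i) ≤ R - 1 / 4 → g (y j) ∈ Set.range y') →
      (∀ j' : Fin N', dist (y' j') (y' i') ≤ R - 1 / 4 → y' j' ∈ g '' Set.range y) →
      Φ N y i = Φ N' y' i') ∧
    (∀ ε : ℝ, 0 < ε → ∃ θ : ℝ, 0 < θ ∧
      ∀ (N N' : ℕ) (y : Fin N → E3) (y' : Fin N' → E3) (i : Fin N) (i' : Fin N')
        (g : E3 ≃ᵃⁱ[ℝ] E3),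
        Function.Injective y → Function.Injective y' → IsSeparated y → IsSeparated y' →
        g (y i) = y' i' →
        (∃ e : {j : Fin N // dist (y j) (y i) ≤ R} ≃ {j' : Fin N' // dist (y' j') (y' i') ≤ R},
          ∀ j, dist (g (y j.1)) (y' (e j).1) ≤ θ) →
        |Φ N y i - Φ N' y' i'| ≤ ε) ∧
    (∀ (N : ℕ) (y : Fin N → E3) (i : Fin N), Function.Injective y → IsSeparated y →
      Φ N y i = 0 → ∀ δ : ℝ, 0 < δ →
        ∃ (a c : ℝ) (s : ℤ → ℤ) (g : E3 ≃ᵃⁱ[ℝ] E3), 0 < a ∧ 9 / 2 * a ≤ R ∧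
          812 / 1000 * a ≤ c ∧ c ≤ 821 / 1000 * a ∧ IsHaggSeq s ∧
          (∀ j k : Fin N, j ≠ k → dist (y j) (y i) ≤ 4 * a → a / 2 ≤ dist (y j) (y k)) ∧
          BallMatch (δ * a) (4 * a) (y i) (Set.range y) (g '' barlowStacking a c s)) ∧
    (∀ ε : ℝ, 0 < ε → ∃ (N : ℕ) (y : Fin N → E3), 0 < N ∧ Function.Injective y ∧
      interactionEnergy Vχ y ≤ (N : ℝ) * (e₀ + ε))

/-- **The certificate-ready form implies the core**: summing the pointwise m-potential inequality
over the sites, the antisymmetric transfer cancels (`Finset.sum_comm`) and `Σ e_i/2 = E_χ`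
(`two_mul_interactionEnergy`), leaving the domination `Σ Φ ≤ E_χ − N e₀`; all other clauses are
shared. -/
theorem sharpLocalisationSeparated_of_certificate (h : LocalTransferCertificate) :
    SharpLocalisationSeparated := by
  obtain ⟨R, e₀, Φ, T, hR, hanti, -, -, hpt, hloc, hcont, hzero, hclu⟩ := h
  refine ⟨R, e₀, Φ, hR, fun N y hy hsep => ?_, fun N y i hy hsep => (hpt N y i hy hsep).1, hloc,
    hcont, hzero, hclu⟩
  -- the transfer sums to zero by antisymmetry
  have hT : ∑ i, ∑ j, T N y i j = 0 := by
    have h1 : ∑ i, ∑ j, T N y i j = ∑ i, ∑ j, -T N y j i :=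
      Finset.sum_congr rfl fun i _ => Finset.sum_congr rfl fun j _ => hanti N y i j hy hsep
    have h2 : ∑ i, ∑ j, -T N y j i = -∑ i, ∑ j, T N y i j := by
      rw [Finset.sum_comm]
      simp only [Finset.sum_neg_distrib]
    linarith
  have hE : ∑ i, siteEnergy Vχ y i / 2 = interactionEnergy Vχ y := by
    rw [← Finset.sum_div, ← two_mul_interactionEnergy]
    ring
  have hle : ∑ i, Φ N y i ≤ ∑ i, (siteEnergy Vχ y i / 2 + ∑ j, T N y i j - e₀) :=
    Finset.sum_le_sum fun i _ => by linarith [(hpt N y i hy hsep).2]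
  rw [Finset.sum_sub_distrib, Finset.sum_add_distrib, hT, hE] at hle
  simpa using hle

/-- THE CORE MINUS ITS ZERO-SET CLAUSE (lead c3 probe): every clause of
`SharpLocalisationSeparated` except the SHARP ZERO SET — domination, positivity, patch-locality,
matching-continuity and the cluster clause.  PROVED below with `H ≡ 0` and
`e₀ := inf {E_χ(y)/N}` over non-empty `1/4`-separated finite injective clusters
(`sharpLocalisationSeparated_sans_zeroSet`): so 100 % of the content of the core stub is the
identification of the zero set of a non-negative local functional dominated by `E_χ − N e₀` with
near-Barlow patches, i.e. finite-range energetic crystallization for `V_χ` (declared in the card;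
here certified as the ONLY content). -/
def SharpLocalisationSeparatedSansZeroSet : Prop :=
  ∃ (R e₀ : ℝ) (H : SiteFun), 9 / 4 ≤ R ∧
    (∀ (N : ℕ) (y : Fin N → E3), Function.Injective y → IsSeparated y →
      ∑ i, H N y i ≤ interactionEnergy Vχ y - (N : ℝ) * e₀) ∧
    (∀ (N : ℕ) (y : Fin N → E3) (i : Fin N), Function.Injective y → IsSeparated y → 0 ≤ H N y i) ∧
    (∀ (N N' : ℕ) (y : Fin N → E3) (y' : Fin N' → E3) (i : Fin N) (i' : Fin N') (g : E3 ≃ᵃⁱ[ℝ] E3),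
      Function.Injective y → Function.Injective y' → IsSeparated y → IsSeparated y' →
      g (y i) = y' i' →
      (∀ j : Fin N, dist (y j) (y i) ≤ R - 1 / 4 → g (y j) ∈ Set.range y') →
      (∀ j' : Fin N', dist (y' j') (y' i') ≤ R - 1 / 4 → y' j' ∈ g '' Set.range y) →
      H N y i = H N' y' i') ∧
    (∀ ε : ℝ, 0 < ε → ∃ θ : ℝ, 0 < θ ∧
      ∀ (N N' : ℕ) (y : Fin N → E3) (y' : Fin N' → E3) (i : Fin N) (i' : Fin N')
        (g : E3 ≃ᵃⁱ[ℝ] E3),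
        Function.Injective y → Function.Injective y' → IsSeparated y → IsSeparated y' →
        g (y i) = y' i' →
        (∃ e : {j : Fin N // dist (y j) (y i) ≤ R} ≃ {j' : Fin N' // dist (y' j') (y' i') ≤ R},
          ∀ j, dist (g (y j.1)) (y' (e j).1) ≤ θ) →
        |H N y i - H N' y' i'| ≤ ε) ∧
    (∀ ε : ℝ, 0 < ε → ∃ (N : ℕ) (y : Fin N → E3), 0 < N ∧ Function.Injective y ∧
      interactionEnergy Vχ y ≤ (N : ℝ) * (e₀ + ε))

/-- `V_LJ ≤ V_χ` pointwise (`χ = 1` wherever `V_LJ > 0`, `χ ≤ 1` where `V_LJ ≤ 0`). -/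
theorem lennardJones_le_Vχ (r : ℝ) : lennardJones r ≤ Vχ r := by
  have hchi1 : min 1 (max 0 (4 - 2 * r)) ≤ 1 := min_le_left _ _
  rcases le_or_gt (lennardJones r) 0 with h | h
  · have := mul_le_mul_of_nonpos_right hchi1 h
    simpa [Vχ] using this
  · rcases le_or_gt r (3 / 2) with hr | hr
    · have hchi : min 1 (max 0 (4 - 2 * r)) = 1 := min_eq_left (le_max_of_le_right (by linarith))
      simp [Vχ, hchi]
    · have : lennardJones r ≤ 0 := lennardJones_nonpos (by linarith)
      linarith

/-- `V_χ` is stable on finite injective configurations: `E_χ(x) ≥ −C·N` (from the tree's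
`lennardJones_stable_holds` and `V_LJ ≤ V_χ`). -/
theorem Vχ_stable : ∃ C : ℝ, ∀ (N : ℕ) (x : Fin N → E3),
    Function.Injective x → -(C * (N : ℝ)) ≤ interactionEnergy Vχ x := by
  obtain ⟨C, hC⟩ := lennardJones_stable_holds 3 (by norm_num)
  refine ⟨C, fun N x hx => (hC N x hx).trans ?_⟩
  exact Finset.sum_le_sum fun _ _ => Finset.sum_le_sum fun _ _ => lennardJones_le_Vχ _

/-- **The core minus its zero-set clause is vacuous** (`H ≡ 0`, `e₀` the infimum of `E_χ/N` over
non-empty `1/4`-separated finite injective clusters, which exists by stability of `V_χ`): every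
clause of `stub_sharpLocalisationSeparated` other than the sharp zero set holds trivially.  Hence the
registered core is EXACTLY the statement "the zero set of some such `H` consists of near-Barlow
patches" — finite-range energetic crystallization for `V_χ` in `d = 3`, nothing less. -/
theorem sharpLocalisationSeparated_sans_zeroSet : SharpLocalisationSeparatedSansZeroSet := by
  obtain ⟨C, hC⟩ := Vχ_stable
  -- the set of energies per particle of non-empty separated injective clusters
  set S : Set ℝ := {t | ∃ (N : ℕ) (y : Fin N → E3), 0 < N ∧ Function.Injective y ∧ IsSeparated y ∧
    t = interactionEnergy Vχ y / N} with hS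
  have hne : S.Nonempty := by
    refine ⟨interactionEnergy Vχ (fun _ : Fin 1 => (0 : E3)) / (1 : ℕ), 1, fun _ => 0, Nat.one_pos,
      fun i j _ => Subsingleton.elim i j, fun j k hjk => absurd (Subsingleton.elim j k) hjk, rfl⟩
  have hbdd : BddBelow S := by
    refine ⟨-C, ?_⟩
    rintro t ⟨N, y, hN, hy, -, rfl⟩
    have hN' : (0 : ℝ) < N := by exact_mod_cast hN
    rw [le_div_iff₀ hN']
    linarith [hC N y hy]
  refine ⟨9 / 4, sInf S, fun _ _ _ => 0, le_rfl, fun N y hy hsep => ?_, fun _ _ _ _ _ => le_rfl,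
    fun _ _ _ _ _ _ _ _ _ _ _ _ _ _ => rfl, fun ε hε => ⟨1, one_pos, fun _ _ _ _ _ _ _ _ _ _ _ _ _ => ?_⟩,
    fun ε hε => ?_⟩
  · -- domination: `0 ≤ E − N e₀`, i.e. `e₀ ≤ E/N` for `N > 0`
    simp only [Finset.sum_const_zero, sub_nonneg]
    rcases Nat.eq_zero_or_pos N with hN | hN
    · subst hN
      simp [interactionEnergy]
    · have hN' : (0 : ℝ) < N := by exact_mod_cast hN
      have hmem : interactionEnergy Vχ y / N ∈ S := ⟨N, y, hN, hy, hsep, rfl⟩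
      have := csInf_le hbdd hmem
      rwa [le_div_iff₀ hN', mul_comm] at this
  · simp [hε.le]
  · -- cluster clause: an element of `S` below `e₀ + ε`
    obtain ⟨t, ⟨N, y, hN, hy, -, rfl⟩, hlt⟩ := exists_lt_of_csInf_lt hne (lt_add_of_pos_right _ hε)
    refine ⟨N, y, hN, hy, ?_⟩
    have hN' : (0 : ℝ) < N := by exact_mod_cast hN
    rw [div_lt_iff₀ hN'] at hlt
    linarith

/-- STATEMENT of `stub_separatedReduction` (r3; L, provable NOW from the landed stub 1) — THE
SEPARATED REDUCTION: a sharp m-potential on `1/4`-separated configurations plus the superstability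
redistribution (at its landed radius `9/4`) give the sharp m-potential on ALL finite injective
configurations, `SharpLocalisationSeparated → SuperstableRedistribution94 → SharpLocalisation`.  Construction: with
`F` from the redistribution (radius `9/4`) and `y_cf = y ∘ f` the sub-configuration of `1/4`-crowd-free
sites (canonically enumerated), put `H_i := H^sep(y_cf)(i) + [e_i/2 + F_i − e^cf_i/2]` at crowd-free
`i` and `H_i := e_i/2 + F_i − e₀` at crowded `i`; then `Σ_i H_i = E_χ − N e₀` (sum rule of `H^sep` on
the separated `y_cf`, `Σ F = 0`, `Σ e_i/2 = E_χ(y)`, `Σ_cf e^cf_i/2 = E_χ(y_cf)`), `H ≥ 0` (the bracket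
is `≥ 0` by the redistribution, `1 − e₀ ≥ 1` at crowded sites since `e₀ ≤ 0` from the one-point
configuration), floor `M₀ = 1` at `r₀ = 1/4`-crowded sites, patch-locality at radius `R`, and — on
`1/4`-TAME `R`-patches, where `F_i = 0`, the bracket vanishes and `H_i = H^sep(z)(root)` for the
separated restriction `z` of `y` to the closed `R`-ball (patch-locality of `H^sep` at `R − 1/4`) —
tame-continuity and the zero set transfer from `H^sep` (`9a/2 ≤ R` keeps far partners `a/2` away). -/
def SeparatedReduction : Prop :=
  SharpLocalisationSeparated → SuperstableRedistribution94 → SharpLocalisation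

/-- STATEMENT of `stub_compactnessExtraction` — THE PEIERLS CONSTANT BY COMPACTNESS (abstract, pure
analysis; Holsztyński–Slawny's finite-alphabet minimum as a compactness infimum).  For every `R`-local,
tame-continuous, non-negative site functional whose tame zero set is near-Barlow at radius `4` for all
tolerances, and every `δ > 0`, there is `κ > 0` such that a TAME site with `H_i < κ` is `δ`-near-Barlow
at radius `3`. -/
def CompactnessExtraction : Prop :=
  ∀ (R r₀ : ℝ) (H : SiteFun), 0 < r₀ → IsPatchLocal R H → IsTameContinuous R r₀ H →
    (∀ (N : ℕ) (y : Fin N → E3) (i : Fin N), Function.Injective y → 0 ≤ H N y i) →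
    (∀ (N : ℕ) (y : Fin N → E3) (i : Fin N), Function.Injective y → IsTamePatch R r₀ y i →
      H N y i = 0 → ∀ δ : ℝ, 0 < δ →
        ∃ (a c : ℝ) (s : ℤ → ℤ) (g : E3 ≃ᵃⁱ[ℝ] E3), 0 < a ∧ 4 * a ≤ R ∧
          812 / 1000 * a ≤ c ∧ c ≤ 821 / 1000 * a ∧ IsHaggSeq s ∧
          (∀ j k : Fin N, j ≠ k → dist (y j) (y i) ≤ 4 * a → a / 2 ≤ dist (y j) (y k)) ∧
          BallMatch (δ * a) (4 * a) (y i) (Set.range y) (g '' barlowStacking a c s)) →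
    ∀ δ : ℝ, 0 < δ → ∃ κ : ℝ, 0 < κ ∧
      ∀ (N : ℕ) (y : Fin N → E3) (i : Fin N), Function.Injective y → IsTamePatch R r₀ y i →
        H N y i < κ → NearBarlow δ 3 y i

/-- STATEMENT of `stub_chargeFreeOpenAtBarlow` — THE OPEN MARGIN OF CHARGE-FREENESS AT BARLOW PATCHES
(the card's First lemma, radius `3a`, layer spacing freed to the window `[0.812a, 0.821a]`): for some
`δ > 0` (expected `1/1000`), a site that is `δ`-near-Barlow at radius `3` is charge-free at the fixed
tolerance `1/100` (twelve bonds = the matched first shell, spread `≤ 0.37 % + 4δ < 1 %`; every other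
distance `≥ 1.40a`; ring numbers `4`). -/
def ChargeFreeOpenAtBarlow : Prop :=
  ∃ δ : ℝ, 0 < δ ∧ ∀ (N : ℕ) (y : Fin N → E3) (i : Fin N),
    NearBarlow δ 3 y i → IsChargeFree (1 / 100 : ℝ) y i

/-- STATEMENT of `stub_periodicStability` — PERIODIC STABILITY OF `V_χ`: the energies per particle of
periodic configurations are bounded below (so `e_χ*` is a genuine infimum; the crux implies it,
Disproof §3 / Negative `truncatedCensusGap_bddBelow`). -/
def PeriodicStability : Prop :=
  BddBelow (Set.range fun Q : PeriodicConfiguration 3 => Q.energyPerParticle Vχ)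

/-! ## Registered stubs (SELF-CONTAINED signatures over tree declarations)

Each `stub_*` type spells out the corresponding named statement with `Vχ`, `SiteFun`, `E3`,
`IsPatchLocal`, `IsTameContinuous`, `IsTamePatch`, `IsCrowdFree`, `NearBarlow` unfolded, so that the
registered signature elaborates in a bare `Theorems/` file with
`open Literature.MathematicalPhysics.StatisticalMechanics Literature.Geometry.DiscreteGeometry`
(tree notions used: `lennardJones`, `siteEnergy`, `interactionEnergy`, `PeriodicConfiguration`,
`barlowStacking`, `IsHaggSeq`, `BallMatch`, `IsChargeFree`).  The `example` after each stub checks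
that it is definitionally the named statement. -/

/-- **STUB 1 (M–L) — CLOSED (p124427, lead c2 wave 1).** Ruelle superstability of `V_χ` in transfer
form = `SuperstableRedistribution` spelled out. -/
theorem stub_superstableRedistribution :
    ∃ (ρ : ℝ) (F : (N : ℕ) → (Fin N → EuclideanSpace ℝ (Fin 3)) → Fin N → ℝ),
      (∀ (N N' : ℕ) (y : Fin N → EuclideanSpace ℝ (Fin 3)) (y' : Fin N' → EuclideanSpace ℝ (Fin 3))
          (i : Fin N) (i' : Fin N')
          (g : EuclideanSpace ℝ (Fin 3) ≃ᵃⁱ[ℝ] EuclideanSpace ℝ (Fin 3)),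
        Function.Injective y → Function.Injective y' → g (y i) = y' i' →
        (∀ j : Fin N, dist (y j) (y i) ≤ ρ → g (y j) ∈ Set.range y') →
        (∀ j' : Fin N', dist (y' j') (y' i') ≤ ρ → y' j' ∈ g '' Set.range y) →
        F N y i = F N' y' i') ∧
      (∀ (N : ℕ) (y : Fin N → EuclideanSpace ℝ (Fin 3)), Function.Injective y → ∑ i, F N y i = 0) ∧
      (∀ (N : ℕ) (y : Fin N → EuclideanSpace ℝ (Fin 3)) (i : Fin N), Function.Injective y →
        (∀ j k : Fin N, j ≠ k → dist (y j) (y i) ≤ ρ → dist (y k) (y i) ≤ ρ →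
          1 / 4 ≤ dist (y j) (y k)) →
        F N y i = 0) ∧
      (∀ (N M : ℕ) (y : Fin N → EuclideanSpace ℝ (Fin 3)) (f : Fin M ↪ Fin N) (i : Fin M),
        Function.Injective y →
        (∀ k : Fin N, k ∈ Set.range f ↔ ∀ k' : Fin N, k' ≠ k → 1 / 4 ≤ dist (y k') (y k)) →
        siteEnergy (fun r => min 1 (max 0 (4 - 2 * r)) * lennardJones r) (y ∘ f) i / 2 ≤
          siteEnergy (fun r => min 1 (max 0 (4 - 2 * r)) * lennardJones r) y (f i) / 2
            + F N y (f i)) ∧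
      (∀ (N : ℕ) (y : Fin N → EuclideanSpace ℝ (Fin 3)) (i : Fin N), Function.Injective y →
        ¬ (∀ k : Fin N, k ≠ i → 1 / 4 ≤ dist (y k) (y i)) →
        1 ≤ siteEnergy (fun r => min 1 (max 0 (4 - 2 * r)) * lennardJones r) y i / 2 + F N y i) :=
  Summit.AtomisticToContinuum.Crystallization.Theorems.PricedLinkCensusTruncatedCensusGap.stub_superstableRedistribution

example : SuperstableRedistribution := stub_superstableRedistribution

/-- **STUB 2a (XL; LOAD-BEARING — THE CORE after r3): the sharp m-potential on UNIFORMLY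
`1/4`-SEPARATED configurations** = `SharpLocalisationSeparated` spelled out. -/
theorem stub_sharpLocalisationSeparated :
    ∃ (R e₀ : ℝ) (H : (N : ℕ) → (Fin N → EuclideanSpace ℝ (Fin 3)) → Fin N → ℝ), 9 / 4 ≤ R ∧
      (∀ (N : ℕ) (y : Fin N → EuclideanSpace ℝ (Fin 3)), Function.Injective y →
        (∀ j k : Fin N, j ≠ k → 1 / 4 ≤ dist (y j) (y k)) →
        ∑ i, H N y i ≤
          interactionEnergy (fun r => min 1 (max 0 (4 - 2 * r)) * lennardJones r) y - (N : ℝ) * e₀) ∧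
      (∀ (N : ℕ) (y : Fin N → EuclideanSpace ℝ (Fin 3)) (i : Fin N), Function.Injective y →
        (∀ j k : Fin N, j ≠ k → 1 / 4 ≤ dist (y j) (y k)) → 0 ≤ H N y i) ∧
      (∀ (N N' : ℕ) (y : Fin N → EuclideanSpace ℝ (Fin 3)) (y' : Fin N' → EuclideanSpace ℝ (Fin 3))
          (i : Fin N) (i' : Fin N')
          (g : EuclideanSpace ℝ (Fin 3) ≃ᵃⁱ[ℝ] EuclideanSpace ℝ (Fin 3)),
        Function.Injective y → Function.Injective y' →
        (∀ j k : Fin N, j ≠ k → 1 / 4 ≤ dist (y j) (y k)) →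
        (∀ j k : Fin N', j ≠ k → 1 / 4 ≤ dist (y' j) (y' k)) →
        g (y i) = y' i' →
        (∀ j : Fin N, dist (y j) (y i) ≤ R - 1 / 4 → g (y j) ∈ Set.range y') →
        (∀ j' : Fin N', dist (y' j') (y' i') ≤ R - 1 / 4 → y' j' ∈ g '' Set.range y) →
        H N y i = H N' y' i') ∧
      (∀ ε : ℝ, 0 < ε → ∃ θ : ℝ, 0 < θ ∧
        ∀ (N N' : ℕ) (y : Fin N → EuclideanSpace ℝ (Fin 3)) (y' : Fin N' → EuclideanSpace ℝ (Fin 3))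
          (i : Fin N) (i' : Fin N')
          (g : EuclideanSpace ℝ (Fin 3) ≃ᵃⁱ[ℝ] EuclideanSpace ℝ (Fin 3)),
          Function.Injective y → Function.Injective y' →
          (∀ j k : Fin N, j ≠ k → 1 / 4 ≤ dist (y j) (y k)) →
          (∀ j k : Fin N', j ≠ k → 1 / 4 ≤ dist (y' j) (y' k)) →
          g (y i) = y' i' →
          (∃ e : {j : Fin N // dist (y j) (y i) ≤ R} ≃ {j' : Fin N' // dist (y' j') (y' i') ≤ R},
            ∀ j, dist (g (y j.1)) (y' (e j).1) ≤ θ) →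
          |H N y i - H N' y' i'| ≤ ε) ∧
      (∀ (N : ℕ) (y : Fin N → EuclideanSpace ℝ (Fin 3)) (i : Fin N), Function.Injective y →
        (∀ j k : Fin N, j ≠ k → 1 / 4 ≤ dist (y j) (y k)) →
        H N y i = 0 → ∀ δ : ℝ, 0 < δ →
          ∃ (a c : ℝ) (s : ℤ → ℤ) (g : EuclideanSpace ℝ (Fin 3) ≃ᵃⁱ[ℝ] EuclideanSpace ℝ (Fin 3)),
            0 < a ∧ 9 / 2 * a ≤ R ∧ 812 / 1000 * a ≤ c ∧ c ≤ 821 / 1000 * a ∧ IsHaggSeq s ∧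
            (∀ j k : Fin N, j ≠ k → dist (y j) (y i) ≤ 4 * a → a / 2 ≤ dist (y j) (y k)) ∧
            BallMatch (δ * a) (4 * a) (y i) (Set.range y) (g '' barlowStacking a c s)) ∧
      (∀ ε : ℝ, 0 < ε → ∃ (N : ℕ) (y : Fin N → EuclideanSpace ℝ (Fin 3)), 0 < N ∧
        Function.Injective y ∧
        interactionEnergy (fun r => min 1 (max 0 (4 - 2 * r)) * lennardJones r) y ≤ (N : ℝ) * (e₀ + ε)) := by
  sorry

example : SharpLocalisationSeparated := stub_sharpLocalisationSeparated

/-- **STUB 2b (L) — CLOSED (p126512 + aux p126031, lead c2 wave 2) — THE SEPARATED REDUCTION**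
= `SeparatedReduction` spelled out: `SharpLocalisationSeparated → SuperstableRedistribution →
SharpLocalisation`. -/
theorem stub_separatedReduction :
    (
    ∃ (R e₀ : ℝ) (H : (N : ℕ) → (Fin N → EuclideanSpace ℝ (Fin 3)) → Fin N → ℝ), 9 / 4 ≤ R ∧
      (∀ (N : ℕ) (y : Fin N → EuclideanSpace ℝ (Fin 3)), Function.Injective y →
        (∀ j k : Fin N, j ≠ k → 1 / 4 ≤ dist (y j) (y k)) →
        ∑ i, H N y i ≤
          interactionEnergy (fun r => min 1 (max 0 (4 - 2 * r)) * lennardJones r) y - (N : ℝ) * e₀) ∧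
      (∀ (N : ℕ) (y : Fin N → EuclideanSpace ℝ (Fin 3)) (i : Fin N), Function.Injective y →
        (∀ j k : Fin N, j ≠ k → 1 / 4 ≤ dist (y j) (y k)) → 0 ≤ H N y i) ∧
      (∀ (N N' : ℕ) (y : Fin N → EuclideanSpace ℝ (Fin 3)) (y' : Fin N' → EuclideanSpace ℝ (Fin 3))
          (i : Fin N) (i' : Fin N')
          (g : EuclideanSpace ℝ (Fin 3) ≃ᵃⁱ[ℝ] EuclideanSpace ℝ (Fin 3)),
        Function.Injective y → Function.Injective y' →
        (∀ j k : Fin N, j ≠ k → 1 / 4 ≤ dist (y j) (y k)) →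
        (∀ j k : Fin N', j ≠ k → 1 / 4 ≤ dist (y' j) (y' k)) →
        g (y i) = y' i' →
        (∀ j : Fin N, dist (y j) (y i) ≤ R - 1 / 4 → g (y j) ∈ Set.range y') →
        (∀ j' : Fin N', dist (y' j') (y' i') ≤ R - 1 / 4 → y' j' ∈ g '' Set.range y) →
        H N y i = H N' y' i') ∧
      (∀ ε : ℝ, 0 < ε → ∃ θ : ℝ, 0 < θ ∧
        ∀ (N N' : ℕ) (y : Fin N → EuclideanSpace ℝ (Fin 3)) (y' : Fin N' → EuclideanSpace ℝ (Fin 3))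
          (i : Fin N) (i' : Fin N')
          (g : EuclideanSpace ℝ (Fin 3) ≃ᵃⁱ[ℝ] EuclideanSpace ℝ (Fin 3)),
          Function.Injective y → Function.Injective y' →
          (∀ j k : Fin N, j ≠ k → 1 / 4 ≤ dist (y j) (y k)) →
          (∀ j k : Fin N', j ≠ k → 1 / 4 ≤ dist (y' j) (y' k)) →
          g (y i) = y' i' →
          (∃ e : {j : Fin N // dist (y j) (y i) ≤ R} ≃ {j' : Fin N' // dist (y' j') (y' i') ≤ R},
            ∀ j, dist (g (y j.1)) (y' (e j).1) ≤ θ) →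
          |H N y i - H N' y' i'| ≤ ε) ∧
      (∀ (N : ℕ) (y : Fin N → EuclideanSpace ℝ (Fin 3)) (i : Fin N), Function.Injective y →
        (∀ j k : Fin N, j ≠ k → 1 / 4 ≤ dist (y j) (y k)) →
        H N y i = 0 → ∀ δ : ℝ, 0 < δ →
          ∃ (a c : ℝ) (s : ℤ → ℤ) (g : EuclideanSpace ℝ (Fin 3) ≃ᵃⁱ[ℝ] EuclideanSpace ℝ (Fin 3)),
            0 < a ∧ 9 / 2 * a ≤ R ∧ 812 / 1000 * a ≤ c ∧ c ≤ 821 / 1000 * a ∧ IsHaggSeq s ∧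
            (∀ j k : Fin N, j ≠ k → dist (y j) (y i) ≤ 4 * a → a / 2 ≤ dist (y j) (y k)) ∧
            BallMatch (δ * a) (4 * a) (y i) (Set.range y) (g '' barlowStacking a c s)) ∧
      (∀ ε : ℝ, 0 < ε → ∃ (N : ℕ) (y : Fin N → EuclideanSpace ℝ (Fin 3)), 0 < N ∧
        Function.Injective y ∧
        interactionEnergy (fun r => min 1 (max 0 (4 - 2 * r)) * lennardJones r) y ≤ (N : ℝ) * (e₀ + ε))) →
    (∃ F : (N : ℕ) → (Fin N → EuclideanSpace ℝ (Fin 3)) → Fin N → ℝ,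
      (∀ (N N' : ℕ) (y : Fin N → EuclideanSpace ℝ (Fin 3)) (y' : Fin N' → EuclideanSpace ℝ (Fin 3))
          (i : Fin N) (i' : Fin N')
          (g : EuclideanSpace ℝ (Fin 3) ≃ᵃⁱ[ℝ] EuclideanSpace ℝ (Fin 3)),
        Function.Injective y → Function.Injective y' → g (y i) = y' i' →
        (∀ j : Fin N, dist (y j) (y i) ≤ 9 / 4 → g (y j) ∈ Set.range y') →
        (∀ j' : Fin N', dist (y' j') (y' i') ≤ 9 / 4 → y' j' ∈ g '' Set.range y) →
        F N y i = F N' y' i') ∧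
      (∀ (N : ℕ) (y : Fin N → EuclideanSpace ℝ (Fin 3)), Function.Injective y → ∑ i, F N y i = 0) ∧
      (∀ (N : ℕ) (y : Fin N → EuclideanSpace ℝ (Fin 3)) (i : Fin N), Function.Injective y →
        (∀ j k : Fin N, j ≠ k → dist (y j) (y i) ≤ 9 / 4 → dist (y k) (y i) ≤ 9 / 4 →
          1 / 4 ≤ dist (y j) (y k)) →
        F N y i = 0) ∧
      (∀ (N M : ℕ) (y : Fin N → EuclideanSpace ℝ (Fin 3)) (f : Fin M ↪ Fin N) (i : Fin M),
        Function.Injective y →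
        (∀ k : Fin N, k ∈ Set.range f ↔ ∀ k' : Fin N, k' ≠ k → 1 / 4 ≤ dist (y k') (y k)) →
        siteEnergy (fun r => min 1 (max 0 (4 - 2 * r)) * lennardJones r) (y ∘ f) i / 2 ≤
          siteEnergy (fun r => min 1 (max 0 (4 - 2 * r)) * lennardJones r) y (f i) / 2
            + F N y (f i)) ∧
      (∀ (N : ℕ) (y : Fin N → EuclideanSpace ℝ (Fin 3)) (i : Fin N), Function.Injective y →
        ¬ (∀ k : Fin N, k ≠ i → 1 / 4 ≤ dist (y k) (y i)) →
        1 ≤ siteEnergy (fun r => min 1 (max 0 (4 - 2 * r)) * lennardJones r) y i / 2 + F N y i)) →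
    ∃ (R r₀ e₀ M₀ : ℝ) (H : (N : ℕ) → (Fin N → EuclideanSpace ℝ (Fin 3)) → Fin N → ℝ),
      0 < r₀ ∧ 0 < M₀ ∧
      (∀ (N : ℕ) (y : Fin N → EuclideanSpace ℝ (Fin 3)), Function.Injective y →
        ∑ i, H N y i ≤
          interactionEnergy (fun r => min 1 (max 0 (4 - 2 * r)) * lennardJones r) y - (N : ℝ) * e₀) ∧
      (∀ (N : ℕ) (y : Fin N → EuclideanSpace ℝ (Fin 3)) (i : Fin N), Function.Injective y →
        0 ≤ H N y i) ∧
      (∀ (N N' : ℕ) (y : Fin N → EuclideanSpace ℝ (Fin 3)) (y' : Fin N' → EuclideanSpace ℝ (Fin 3))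
          (i : Fin N) (i' : Fin N')
          (g : EuclideanSpace ℝ (Fin 3) ≃ᵃⁱ[ℝ] EuclideanSpace ℝ (Fin 3)),
        Function.Injective y → Function.Injective y' → g (y i) = y' i' →
        (∀ j : Fin N, dist (y j) (y i) ≤ R → g (y j) ∈ Set.range y') →
        (∀ j' : Fin N', dist (y' j') (y' i') ≤ R → y' j' ∈ g '' Set.range y) →
        H N y i = H N' y' i') ∧
      (∀ ε : ℝ, 0 < ε → ∃ θ : ℝ, 0 < θ ∧
        ∀ (N N' : ℕ) (y : Fin N → EuclideanSpace ℝ (Fin 3)) (y' : Fin N' → EuclideanSpace ℝ (Fin 3))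
          (i : Fin N) (i' : Fin N')
          (g : EuclideanSpace ℝ (Fin 3) ≃ᵃⁱ[ℝ] EuclideanSpace ℝ (Fin 3)),
          Function.Injective y → Function.Injective y' →
          (∀ j k : Fin N, j ≠ k → dist (y j) (y i) ≤ R → dist (y k) (y i) ≤ R →
            r₀ ≤ dist (y j) (y k)) →
          (∀ j k : Fin N', j ≠ k → dist (y' j) (y' i') ≤ R → dist (y' k) (y' i') ≤ R →
            r₀ ≤ dist (y' j) (y' k)) →
          g (y i) = y' i' →
          (∃ e : {j : Fin N // dist (y j) (y i) ≤ R} ≃ {j' : Fin N' // dist (y' j') (y' i') ≤ R},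
            ∀ j, dist (g (y j.1)) (y' (e j).1) ≤ θ) →
          |H N y i - H N' y' i'| ≤ ε) ∧
      (∀ (N : ℕ) (y : Fin N → EuclideanSpace ℝ (Fin 3)) (i : Fin N), Function.Injective y →
        (∀ j k : Fin N, j ≠ k → dist (y j) (y i) ≤ R → dist (y k) (y i) ≤ R →
          r₀ ≤ dist (y j) (y k)) →
        H N y i = 0 → ∀ δ : ℝ, 0 < δ →
          ∃ (a c : ℝ) (s : ℤ → ℤ) (g : EuclideanSpace ℝ (Fin 3) ≃ᵃⁱ[ℝ] EuclideanSpace ℝ (Fin 3)),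
            0 < a ∧ 4 * a ≤ R ∧ 812 / 1000 * a ≤ c ∧ c ≤ 821 / 1000 * a ∧ IsHaggSeq s ∧
            (∀ j k : Fin N, j ≠ k → dist (y j) (y i) ≤ 4 * a → a / 2 ≤ dist (y j) (y k)) ∧
            BallMatch (δ * a) (4 * a) (y i) (Set.range y) (g '' barlowStacking a c s)) ∧
      (∀ (N : ℕ) (y : Fin N → EuclideanSpace ℝ (Fin 3)) (i : Fin N), Function.Injective y →
        ¬ (∀ k : Fin N, k ≠ i → r₀ ≤ dist (y k) (y i)) → M₀ ≤ H N y i) ∧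
      (∀ ε : ℝ, 0 < ε → ∃ (N : ℕ) (y : Fin N → EuclideanSpace ℝ (Fin 3)), 0 < N ∧
        Function.Injective y ∧
        interactionEnergy (fun r => min 1 (max 0 (4 - 2 * r)) * lennardJones r) y ≤ (N : ℝ) * (e₀ + ε)) :=
  Summit.AtomisticToContinuum.Crystallization.Theorems.PricedLinkCensusTruncatedCensusGap.stub_separatedReduction

example : SeparatedReduction := stub_separatedReduction

/-- **STUB 3 (M) — CLOSED (p124882, lead c2 wave 1).** Extraction of the Peierls constant by
compactness of the tame patch stratum = `CompactnessExtraction` spelled out. -/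
theorem stub_compactnessExtraction :
    ∀ (R r₀ : ℝ) (H : (N : ℕ) → (Fin N → EuclideanSpace ℝ (Fin 3)) → Fin N → ℝ), 0 < r₀ →
      (∀ (N N' : ℕ) (y : Fin N → EuclideanSpace ℝ (Fin 3)) (y' : Fin N' → EuclideanSpace ℝ (Fin 3))
          (i : Fin N) (i' : Fin N')
          (g : EuclideanSpace ℝ (Fin 3) ≃ᵃⁱ[ℝ] EuclideanSpace ℝ (Fin 3)),
        Function.Injective y → Function.Injective y' → g (y i) = y' i' →
        (∀ j : Fin N, dist (y j) (y i) ≤ R → g (y j) ∈ Set.range y') →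
        (∀ j' : Fin N', dist (y' j') (y' i') ≤ R → y' j' ∈ g '' Set.range y) →
        H N y i = H N' y' i') →
      (∀ ε : ℝ, 0 < ε → ∃ θ : ℝ, 0 < θ ∧
        ∀ (N N' : ℕ) (y : Fin N → EuclideanSpace ℝ (Fin 3)) (y' : Fin N' → EuclideanSpace ℝ (Fin 3))
          (i : Fin N) (i' : Fin N')
          (g : EuclideanSpace ℝ (Fin 3) ≃ᵃⁱ[ℝ] EuclideanSpace ℝ (Fin 3)),
          Function.Injective y → Function.Injective y' →
          (∀ j k : Fin N, j ≠ k → dist (y j) (y i) ≤ R → dist (y k) (y i) ≤ R →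
            r₀ ≤ dist (y j) (y k)) →
          (∀ j k : Fin N', j ≠ k → dist (y' j) (y' i') ≤ R → dist (y' k) (y' i') ≤ R →
            r₀ ≤ dist (y' j) (y' k)) →
          g (y i) = y' i' →
          (∃ e : {j : Fin N // dist (y j) (y i) ≤ R} ≃ {j' : Fin N' // dist (y' j') (y' i') ≤ R},
            ∀ j, dist (g (y j.1)) (y' (e j).1) ≤ θ) →
          |H N y i - H N' y' i'| ≤ ε) →
      (∀ (N : ℕ) (y : Fin N → EuclideanSpace ℝ (Fin 3)) (i : Fin N), Function.Injective y →
        0 ≤ H N y i) →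
      (∀ (N : ℕ) (y : Fin N → EuclideanSpace ℝ (Fin 3)) (i : Fin N), Function.Injective y →
        (∀ j k : Fin N, j ≠ k → dist (y j) (y i) ≤ R → dist (y k) (y i) ≤ R →
          r₀ ≤ dist (y j) (y k)) →
        H N y i = 0 → ∀ δ : ℝ, 0 < δ →
          ∃ (a c : ℝ) (s : ℤ → ℤ) (g : EuclideanSpace ℝ (Fin 3) ≃ᵃⁱ[ℝ] EuclideanSpace ℝ (Fin 3)),
            0 < a ∧ 4 * a ≤ R ∧ 812 / 1000 * a ≤ c ∧ c ≤ 821 / 1000 * a ∧ IsHaggSeq s ∧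
            (∀ j k : Fin N, j ≠ k → dist (y j) (y i) ≤ 4 * a → a / 2 ≤ dist (y j) (y k)) ∧
            BallMatch (δ * a) (4 * a) (y i) (Set.range y) (g '' barlowStacking a c s)) →
      ∀ δ : ℝ, 0 < δ → ∃ κ : ℝ, 0 < κ ∧
        ∀ (N : ℕ) (y : Fin N → EuclideanSpace ℝ (Fin 3)) (i : Fin N), Function.Injective y →
          (∀ j k : Fin N, j ≠ k → dist (y j) (y i) ≤ R → dist (y k) (y i) ≤ R →
            r₀ ≤ dist (y j) (y k)) →
          H N y i < κ →
          ∃ (a c : ℝ) (s : ℤ → ℤ) (g : EuclideanSpace ℝ (Fin 3) ≃ᵃⁱ[ℝ] EuclideanSpace ℝ (Fin 3)),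
            0 < a ∧ 812 / 1000 * a ≤ c ∧ c ≤ 821 / 1000 * a ∧ IsHaggSeq s ∧
            (∀ j k : Fin N, j ≠ k → dist (y j) (y i) ≤ 3 * a → a / 2 ≤ dist (y j) (y k)) ∧
            BallMatch (δ * a) (3 * a) (y i) (Set.range y) (g '' barlowStacking a c s) :=
  Summit.AtomisticToContinuum.Crystallization.Theorems.PricedLinkCensusTruncatedCensusGap.stub_compactnessExtraction

example : CompactnessExtraction := stub_compactnessExtraction

/-- **STUB 4 (M) — CLOSED (p125113, lead c2 wave 1; δ = 1/2000).** The open margin of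
charge-freeness at Barlow patches = `ChargeFreeOpenAtBarlow` spelled out. -/
theorem stub_chargeFreeOpenAtBarlow :
    ∃ δ : ℝ, 0 < δ ∧ ∀ (N : ℕ) (y : Fin N → EuclideanSpace ℝ (Fin 3)) (i : Fin N),
      (∃ (a c : ℝ) (s : ℤ → ℤ) (g : EuclideanSpace ℝ (Fin 3) ≃ᵃⁱ[ℝ] EuclideanSpace ℝ (Fin 3)),
          0 < a ∧ 812 / 1000 * a ≤ c ∧ c ≤ 821 / 1000 * a ∧ IsHaggSeq s ∧
          (∀ j k : Fin N, j ≠ k → dist (y j) (y i) ≤ 3 * a → a / 2 ≤ dist (y j) (y k)) ∧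
          BallMatch (δ * a) (3 * a) (y i) (Set.range y) (g '' barlowStacking a c s)) →
      IsChargeFree (1 / 100 : ℝ) y i :=
  Summit.AtomisticToContinuum.Crystallization.Theorems.PricedLinkCensusTruncatedCensusGap.stub_chargeFreeOpenAtBarlow

example : ChargeFreeOpenAtBarlow := stub_chargeFreeOpenAtBarlow

/-- **STUB 5 (S; LANDED as `Theorems.PricedLinkCensusTruncatedCensusGap.stub_periodicStability`,
p84999).** Periodic stability of the truncated potential = `PeriodicStability` spelled out. -/
theorem stub_periodicStability :
    BddBelow (Set.range fun Q : PeriodicConfiguration 3 =>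
      Q.energyPerParticle fun r => min 1 (max 0 (4 - 2 * r)) * lennardJones r) :=
  Summit.AtomisticToContinuum.Crystallization.Theorems.PricedLinkCensusTruncatedCensusGap.stub_periodicStability

example : PeriodicStability := stub_periodicStability

/-! ## Name-keyed aliases of the five statements (hypotheses of the composition)

`Registered.stub_X` is the statement of `stub_X` under the registered stub's short name, so that the
native skeleton audit (`#h21_check_skeleton`: hypotheses admissible iff registered obligations / declared
stubs BY NAME) accepts `TruncatedCensusGap_of : Registered.stub_… → … → TruncatedCensusGap`. -/
namespace Registered

/-- Alias of `SuperstableRedistribution` keyed by the registered stub name. -/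
abbrev stub_superstableRedistribution : Prop := SuperstableRedistribution
/-- Alias of `SharpLocalisationSeparated` keyed by the registered stub name (r3 core). -/
abbrev stub_sharpLocalisationSeparated : Prop := SharpLocalisationSeparated
/-- Alias of `SeparatedReduction` keyed by the registered stub name (r3). -/
abbrev stub_separatedReduction : Prop := SeparatedReduction
/-- Alias of `CompactnessExtraction` keyed by the registered stub name. -/
abbrev stub_compactnessExtraction : Prop := CompactnessExtraction
/-- Alias of `ChargeFreeOpenAtBarlow` keyed by the registered stub name. -/
abbrev stub_chargeFreeOpenAtBarlow : Prop := ChargeFreeOpenAtBarlow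
/-- Alias of `PeriodicStability` keyed by the registered stub name. -/
abbrev stub_periodicStability : Prop := PeriodicStability

end Registered

/-! ## Proved glue: packing of crowd-free sites, rich witnesses, double counting -/

/-- A non-tame patch contains a CROWDED site within `R` of its root. -/
theorem exists_crowded_near_of_not_isTamePatch {N : ℕ} {y : Fin N → E3} {R r₀ : ℝ} {i : Fin N}
    (h : ¬ IsTamePatch R r₀ y i) : ∃ j : Fin N, ¬ IsCrowdFree r₀ y j ∧ dist (y i) (y j) ≤ R := by
  unfold IsTamePatch at h
  push Not at h
  obtain ⟨j, k, hjk, hj, -, hlt⟩ := h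
  refine ⟨j, fun hiso => ?_, by rwa [dist_comm]⟩
  have := hiso k hjk.symm
  rw [dist_comm] at this
  linarith

/-- PACKING: at most `(2R/r₀ + 1)³` crowd-free sites (scale `r₀ > 0`) lie within `R` of any point —
crowd-free sites are `r₀`-separated from everything (tree lemma `card_le_of_separated_of_dist_le`). -/
theorem card_crowdFree_near_le {N : ℕ} {y : Fin N → E3} (hy : Function.Injective y) {r₀ R : ℝ}
    (hr₀ : 0 < r₀) (hR : 0 ≤ R) (j : Fin N) :
    ((Finset.univ.filter fun i : Fin N => IsCrowdFree r₀ y i ∧ dist (y i) (y j) ≤ R).card : ℝ) ≤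
      (2 * R / r₀ + 1) ^ Module.finrank ℝ E3 := by
  set S := Finset.univ.filter fun i : Fin N => IsCrowdFree r₀ y i ∧ dist (y i) (y j) ≤ R with hS
  have hcard : (S.image y).card = S.card := Finset.card_image_of_injective _ hy
  have h := card_le_of_separated_of_dist_le (S.image y) (y j) hr₀ hR ?_ ?_
  · rw [hcard] at h
    exact h
  · intro c hc
    obtain ⟨i, hi, rfl⟩ := Finset.mem_image.1 hc
    exact (Finset.mem_filter.1 hi).2.2
  · intro c hc d hd hcd
    obtain ⟨i, hi, rfl⟩ := Finset.mem_image.1 hc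
    obtain ⟨i', hi', rfl⟩ := Finset.mem_image.1 hd
    have hne : i ≠ i' := fun h => hcd (h ▸ rfl)
    exact (Finset.mem_filter.1 hi').2.1 i hne

/-- DOUBLE COUNTING: a set of crowd-free sites each of which has a crowded site within `R` has at most
`(2R/r₀ + 1)³` times as many elements as there are crowded sites. -/
theorem card_le_mul_card_crowded {N : ℕ} {y : Fin N → E3} (hy : Function.Injective y) {r₀ R : ℝ}
    (hr₀ : 0 < r₀) (hR : 0 ≤ R) (P : Finset (Fin N))
    (hP : ∀ i ∈ P, IsCrowdFree r₀ y i ∧ ∃ j : Fin N, ¬ IsCrowdFree r₀ y j ∧ dist (y i) (y j) ≤ R) :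
    (P.card : ℝ) ≤ (2 * R / r₀ + 1) ^ Module.finrank ℝ E3 *
      ((Finset.univ.filter fun j : Fin N => ¬ IsCrowdFree r₀ y j).card : ℝ) := by
  set K : ℝ := (2 * R / r₀ + 1) ^ Module.finrank ℝ E3 with hK
  have hK0 : 0 ≤ K := by positivity
  -- the witness map: a crowded site within `R`
  let w : Fin N → Fin N := fun i =>
    if h : ∃ j : Fin N, ¬ IsCrowdFree r₀ y j ∧ dist (y i) (y j) ≤ R then Classical.choose h else i
  have hw : ∀ i ∈ P, ¬ IsCrowdFree r₀ y (w i) ∧ dist (y i) (y (w i)) ≤ R := by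
    intro i hi
    obtain ⟨-, hex⟩ := hP i hi
    simp only [w, dif_pos hex]
    exact Classical.choose_spec hex
  have himg : P.image w ⊆ Finset.univ.filter fun j : Fin N => ¬ IsCrowdFree r₀ y j := by
    intro j hj
    obtain ⟨i, hi, rfl⟩ := Finset.mem_image.1 hj
    exact Finset.mem_filter.2 ⟨Finset.mem_univ _, (hw i hi).1⟩
  have hfib : ∀ j ∈ P.image w, ((P.filter fun i => w i = j).card : ℝ) ≤ K := by
    intro j _
    have hsub : (P.filter fun i => w i = j) ⊆
        Finset.univ.filter fun i : Fin N => IsCrowdFree r₀ y i ∧ dist (y i) (y j) ≤ R := by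
      intro i hi
      obtain ⟨hiP, hwi⟩ := Finset.mem_filter.1 hi
      refine Finset.mem_filter.2 ⟨Finset.mem_univ _, (hP i hiP).1, ?_⟩
      have := (hw i hiP).2
      rwa [hwi] at this
    calc ((P.filter fun i => w i = j).card : ℝ)
        ≤ ((Finset.univ.filter fun i : Fin N => IsCrowdFree r₀ y i ∧ dist (y i) (y j) ≤ R).card : ℝ) := by
          exact_mod_cast Finset.card_le_card hsub
      _ ≤ K := card_crowdFree_near_le hy hr₀ hR j
  have hsum : P.card = ∑ j ∈ P.image w, (P.filter fun i => w i = j).card :=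
    Finset.card_eq_sum_card_image w P
  calc (P.card : ℝ) = ∑ j ∈ P.image w, ((P.filter fun i => w i = j).card : ℝ) := by
        rw [hsum]
        push_cast
        rfl
    _ ≤ ∑ j ∈ P.image w, K := Finset.sum_le_sum hfib
    _ = K * (P.image w).card := by rw [Finset.sum_const, nsmul_eq_mul, mul_comm]
    _ ≤ K * ((Finset.univ.filter fun j : Fin N => ¬ IsCrowdFree r₀ y j).card : ℝ) := by
        have himg' : ((P.image w).card : ℝ) ≤
            ((Finset.univ.filter fun j : Fin N => ¬ IsCrowdFree r₀ y j).card : ℝ) := by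
          exact_mod_cast Finset.card_le_card himg
        exact mul_le_mul_of_nonneg_left himg' hK0

/-! ## Stub 1 at its landed radius -/

section SR94
open Summit.AtomisticToContinuum.Crystallization.Theorems.PricedLinkCensusTruncatedCensusGap

/-- **`SuperstableRedistribution94`** — the LANDED superstability redistribution (p124427) re-assembled
at its explicit radius `ρ = 9/4` from the landed file's public lemmas (`cloud_eq_image`,
`cloud_sum_image`, `cloud_sum_eq_global`, `global_sum_eq_zero`, `global_eq_zero_of_tame`,
`sub_le_global`, `one_le_global`): the cloud-form transfer `F`. -/
theorem superstableRedistribution94 : SuperstableRedistribution94 := by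
  obtain ⟨t, ht⟩ : ∃ t : ℝ → ℕ → ℕ → ℝ, ∀ v a b, t v a b =
      if v < 0 then (if a < b then -v / 2 else if b < a then v / 2 else 0) else 0 :=
    ⟨fun v a b => if v < 0 then (if a < b then -v / 2 else if b < a then v / 2 else 0) else 0,
      fun _ _ _ => rfl⟩
  obtain ⟨F, hF⟩ : ∃ F : (N : ℕ) → (Fin N → EuclideanSpace ℝ (Fin 3)) → Fin N → ℝ,
      ∀ N y i, F N y i = ∑ p ∈ (Finset.univ.filter fun k => dist (y k) (y i) ≤ 9 / 4).image y,
        t (min 1 (max 0 (4 - 2 * dist (y i) p)) * lennardJones (dist (y i) p))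
          ((((Finset.univ.filter fun k => dist (y k) (y i) ≤ 9 / 4).image y).filter
            fun q => dist q (y i) < 1 / 4).card)
          ((((Finset.univ.filter fun k => dist (y k) (y i) ≤ 9 / 4).image y).filter
            fun q => dist q p < 1 / 4).card) := ⟨fun N y i => _, fun _ _ _ => rfl⟩
  refine ⟨F, fun N N' y y' i i' g _ _ hg h1 h2 => ?_, fun N y hy => ?_,
    fun N y i hy htame => ?_, fun N M y f i hy hf => ?_, fun N y i hy hcrowd => ?_⟩
  · rw [hF, hF, cloud_eq_image y y' i i' g hg h1 h2, ← hg]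
    exact (cloud_sum_image (fun d a b => t (min 1 (max 0 (4 - 2 * d)) * lennardJones d) a b)
      _ (y i) g).symm
  · rw [Finset.sum_congr rfl fun i _ => (hF N y i).trans (cloud_sum_eq_global t ht y hy i)]
    exact global_sum_eq_zero t ht y (fun r => min 1 (max 0 (4 - 2 * r)) * lennardJones r)
      fun k => (Finset.univ.filter fun j => dist (y j) (y k) < 1 / 4).card
  · rw [hF, cloud_sum_eq_global t ht y hy i]
    exact global_eq_zero_of_tame t ht y _ (fun _ => rfl) _ (fun _ => rfl) i htame
  · rw [hF, cloud_sum_eq_global t ht y hy (f i)]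
    exact sub_le_global t ht y _ _ (fun _ => rfl) f i hf
  · rw [hF, cloud_sum_eq_global t ht y hy i]
    exact one_le_global t ht y hy _ (fun _ => rfl) _ (fun _ => rfl) i hcrowd

end SR94

/-! ## The composition: the five stubs imply the crux BY NAME -/

/-- **`TruncatedCensusGap` from the ONE open registered stub of r3, the separated core
`stub_sharpLocalisationSeparated`** (everything else is LANDED and discharged inside: p124427 stub 1 at
radius 9/4, p126512 the separated reduction, p124882 compactness extraction, p125113 the open margin,
p84999 periodic stability).  Logic: the sharp m-potential `H` (stub 2
fed by stub 1) sums to `E_χ − N e₀` and is `≥ 0`; compactness (stub 3) at the tolerance `δ₁` of the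
open margin (stub 4) makes `H ≥ κ` at every CHARGED crowd-free tame site; crowded sites carry
`H ≥ M₀`; a charged crowd-free NON-tame site has a crowded site within `R`, and at most
`K = (2R/r₀+1)³` crowd-free sites surround any point (packing), so with `κ' = min κ (M₀/(K+1))`,
`Σ H ≥ κ' · #charged`; finally `N e_χ* ≤ N e₀` by periodic stability (stub 5), the cluster clause and
the landed `iInf_energyPerParticle_le_div`. -/
theorem TruncatedCensusGap_of (hcore : Registered.stub_sharpLocalisationSeparated) :
    TruncatedCensusGap := by
  have hred : SeparatedReduction := stub_separatedReduction
  have hSL : SharpLocalisation := hred hcore superstableRedistribution94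
  have h₃ : CompactnessExtraction := stub_compactnessExtraction
  have h₂ : ChargeFreeOpenAtBarlow := stub_chargeFreeOpenAtBarlow
  have h₅ : PeriodicStability := stub_periodicStability
  obtain ⟨R, r₀, e₀, M₀, H, hr₀, hM₀, hsum, hnn, hloc, hcont, hzero, hrich, hclu⟩ := hSL
  obtain ⟨δ₁, hδ₁, hmargin⟩ := h₂
  obtain ⟨κ, hκ, hfloor⟩ := h₃ R r₀ H hr₀ hloc hcont hnn hzero δ₁ hδ₁
  -- (1) `e_χ* ≤ e₀`
  have heStar : eStar ≤ e₀ := by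
    refine le_of_forall_pos_le_add fun ε hε => ?_
    obtain ⟨N, y, hN, hy, hE⟩ := hclu ε hε
    have h1 : eStar ≤ interactionEnergy Vχ y / N :=
      Summit.AtomisticToContinuum.Crystallization.Theorems.iInf_energyPerParticle_le_div
        (V := Vχ) (R := 2) Vχ_eq_zero_of_two_le h₅ hy hN
    have hN' : (0 : ℝ) < N := by exact_mod_cast hN
    rw [le_div_iff₀ hN'] at h1
    have h2 : eStar * N ≤ (e₀ + ε) * N := by linarith
    exact le_of_mul_le_mul_right h2 hN'
  -- constants
  set R' : ℝ := max R 0 with hR'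
  have hR'0 : 0 ≤ R' := le_max_right _ _
  set K : ℝ := (2 * R' / r₀ + 1) ^ Module.finrank ℝ E3 with hK
  have hK0 : 0 ≤ K := by positivity
  have hK1 : 0 < K + 1 := by linarith
  have hκ' : 0 < min κ (M₀ / (K + 1)) := lt_min hκ (div_pos hM₀ hK1)
  refine ⟨min κ (M₀ / (K + 1)), hκ', fun N y hy => ?_⟩
  change (N : ℝ) * eStar +
      min κ (M₀ / (K + 1)) * (Nat.card {i : Fin N // ¬ IsChargeFree (1 / 100 : ℝ) y i} : ℝ) ≤
    interactionEnergy Vχ y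
  set κ' : ℝ := min κ (M₀ / (K + 1)) with hκ'def
  have hκ'le1 : κ' ≤ κ := min_le_left _ _
  have hκ'le2 : κ' * (K + 1) ≤ M₀ := by
    have := min_le_right κ (M₀ / (K + 1))
    rwa [le_div_iff₀ hK1] at this
  -- the finsets of the counting
  set Ch := Finset.univ.filter fun i : Fin N => ¬ IsChargeFree (1 / 100 : ℝ) y i with hCh
  set Crowd := Finset.univ.filter fun i : Fin N => ¬ IsCrowdFree r₀ y i with hCrowd
  set TameCh := Ch.filter fun i => IsCrowdFree r₀ y i ∧ IsTamePatch R r₀ y i with hTameCh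
  set Poor := Ch.filter fun i => IsCrowdFree r₀ y i ∧ ¬ IsTamePatch R r₀ y i with hPoor
  have hcardNat : (Nat.card {i : Fin N // ¬ IsChargeFree (1 / 100 : ℝ) y i} : ℝ) = Ch.card := by
    rw [Nat.card_eq_fintype_card, Fintype.card_subtype]
  -- (2) every charged site is tame & crowd-free, or poor (crowd-free, non-tame), or crowded
  have hcover : Ch ⊆ TameCh ∪ Poor ∪ Crowd := by
    intro i hi
    by_cases hiso : IsCrowdFree r₀ y i
    · by_cases ht : IsTamePatch R r₀ y i
      · exact Finset.mem_union_left _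
          (Finset.mem_union_left _ (Finset.mem_filter.2 ⟨hi, hiso, ht⟩))
      · exact Finset.mem_union_left _
          (Finset.mem_union_right _ (Finset.mem_filter.2 ⟨hi, hiso, ht⟩))
    · exact Finset.mem_union_right _ (Finset.mem_filter.2 ⟨Finset.mem_univ _, hiso⟩)
  have hcardCh : (Ch.card : ℝ) ≤ TameCh.card + Poor.card + Crowd.card := by
    have h1 := Finset.card_le_card hcover
    have h2 := Finset.card_union_le (TameCh ∪ Poor) Crowd
    have h3 := Finset.card_union_le TameCh Poor
    exact_mod_cast h1.trans (h2.trans (Nat.add_le_add_right h3 _))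
  -- (3) poor sites are few: `#Poor ≤ K · #Crowd`
  have hPoor : (Poor.card : ℝ) ≤ K * Crowd.card := by
    refine card_le_mul_card_crowded hy hr₀ hR'0 Poor fun i hi => ?_
    obtain ⟨-, hiso, hnt⟩ := Finset.mem_filter.1 hi
    obtain ⟨j, hj, hd⟩ := exists_crowded_near_of_not_isTamePatch hnt
    exact ⟨hiso, j, hj, hd.trans (le_max_left _ _)⟩
  -- (4) floors: compactness + open margin on tame charged sites, `M₀` on crowded sites
  have hTame : ∀ i ∈ TameCh, κ ≤ H N y i := by
    intro i hi
    obtain ⟨hiCh, -, ht⟩ := Finset.mem_filter.1 hi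
    by_contra hlt
    push Not at hlt
    exact (Finset.mem_filter.1 hiCh).2 (hmargin N y i (hfloor N y i hy ht hlt))
  have hCrowdfl : ∀ j ∈ Crowd, M₀ ≤ H N y j := fun j hj =>
    hrich N y j hy (Finset.mem_filter.1 hj).2
  -- (5) the sum of `H` dominates both floors
  have hdisj : Disjoint TameCh Crowd := by
    rw [Finset.disjoint_left]
    intro i hi hi'
    exact (Finset.mem_filter.1 hi').2 (Finset.mem_filter.1 hi).2.1
  have hsumge : κ * TameCh.card + M₀ * Crowd.card ≤ ∑ i, H N y i := by
    have h1 : ∑ i ∈ TameCh ∪ Crowd, H N y i ≤ ∑ i, H N y i :=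
      Finset.sum_le_univ_sum_of_nonneg fun i => hnn N y i hy
    rw [Finset.sum_union hdisj] at h1
    have h2 : κ * TameCh.card ≤ ∑ i ∈ TameCh, H N y i := by
      have := Finset.card_nsmul_le_sum TameCh (fun i => H N y i) κ fun i hi => hTame i hi
      simpa [nsmul_eq_mul, mul_comm] using this
    have h3 : M₀ * Crowd.card ≤ ∑ i ∈ Crowd, H N y i := by
      have := Finset.card_nsmul_le_sum Crowd (fun i => H N y i) M₀ fun i hi => hCrowdfl i hi
      simpa [nsmul_eq_mul, mul_comm] using this
    linarith
  -- (6) assemble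
  have hmain : κ' * Ch.card ≤ ∑ i, H N y i := by
    have hT0 : (0 : ℝ) ≤ TameCh.card := Nat.cast_nonneg _
    have hC0 : (0 : ℝ) ≤ Crowd.card := Nat.cast_nonneg _
    have hκ'0 : 0 ≤ κ' := hκ'.le
    calc κ' * Ch.card ≤ κ' * (TameCh.card + Poor.card + Crowd.card) := by gcongr
      _ ≤ κ' * TameCh.card + κ' * (K + 1) * Crowd.card := by nlinarith
      _ ≤ κ * TameCh.card + M₀ * Crowd.card := by
          have ha : κ' * TameCh.card ≤ κ * TameCh.card := mul_le_mul_of_nonneg_right hκ'le1 hT0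
          have hb : κ' * (K + 1) * Crowd.card ≤ M₀ * Crowd.card :=
            mul_le_mul_of_nonneg_right hκ'le2 hC0
          linarith
      _ ≤ ∑ i, H N y i := hsumge
  have hdom := hsum N y hy
  rw [hcardNat]
  have hN0 : (0 : ℝ) ≤ N := Nat.cast_nonneg N
  have hNe : (N : ℝ) * eStar ≤ (N : ℝ) * e₀ := mul_le_mul_of_nonneg_left heStar hN0
  linarith

/-- Wiring check: the registered stubs feed `TruncatedCensusGap_of` as stated. -/
example : TruncatedCensusGap := TruncatedCensusGap_of stub_sharpLocalisationSeparated

/-- Wiring check: a local transfer certificate closes the crux, through the proved bridge. -/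
example (h : LocalTransferCertificate) : TruncatedCensusGap :=
  TruncatedCensusGap_of (sharpLocalisationSeparated_of_certificate h)

end Summit.AtomisticToContinuum.Crystallization.Cruxes.TruncatedCensusGap.SharpMPotentialCompactness

end
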